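import Literature.ModelTheory.Zilber.EACDensityAligned
import HarnessLib

/-!
# Mantova–Masser's density question on the crossed family `S_{p,q} = {x₁ = p(x₀), y₀ = q(y₁)}`:
# a positive answer for EVERY `p` with `deg p ≥ 2` and EVERY non-constant `q`

This is the seventh file of the `EACDensity*` series (`EACDensityQuestion`: the question and the
abstract Liouville elimination; `EACDensityFamilies`: the crossed family `graphPolySurface p q`
under the leading-coefficient criterion `Re(a_d (σ i)^d) < 0` and `q(0) ≠ 0`;
`EACDensityAligned`: the aligned family and affine fibres). Here the crossed family is settled
for all non-constant fibre polynomials, with NO condition on the leading coefficient of `p` and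
NO condition at `y₁ = 0`:

* `unprojectedDensityQuestion_instance_crossed (hd : 2 ≤ p.natDegree) (hq : 0 < q.natDegree) :
    MMCaseDimPiOneFree (graphPolySurface p q) ∧ UnprojectedDense (graphPolySurface p q)`.

In words: for the algebraic surface `S = {x₁ = p(x₀), y₀ = q(y₁)} ⊂ ℂ² × ℂ²` (which lies in
Mantova–Masser's case (dim-pi-S-1-free) as soon as `deg p ≥ 2`, `q ≠ 0`), the exponential points
`(z, p(z), e^{z}, e^{p(z)})` with `e^{z} = q(e^{p(z)})` are Zariski dense in `S`, i.e.
`I(S ∩ Γ_exp) = I(S)` [MantovaMasser2023, §1, p. 5: "we do not know if they form a Zariski-dense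
subset of S"]. Examples decided here and by no earlier file: `e^{z} = e^{-2z²} + 1`
(`{x₁ = -x₀², y₀ = y₁² + 1}`), `e^{z} = (e^{z³} - 1)²`, `e^{z} = e^{3z²}`.

## The mechanism (new regime: escape TO A ROOT of `q`)

The earlier files used the regime `e^{p(z)} → 0` (which needs `q(0) ≠ 0` and a root direction
making `Re p` very negative while `Re z → -∞` — the leading-coefficient criterion). Here the
roles are swapped: we let `e^{z} → 0` (i.e. `Re z → -∞`, available for EVERY `p` of degree
`≥ 2` through a root direction `ω` of `a ω^d ∈ 2πi{±1}` with `Re ω ≤ -‖ω‖/2`,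
`EACDensityAligned.exists_rootDirection`) and force `e^{p(z)} → β`, a nonzero ROOT of `q`, of
any multiplicity `μ`. Writing `q(β(1+t)) = t^μ Q_μ(t)` with `κ = Q_μ(0) ≠ 0`:

1. (`EACDensityAligned.exists_alRoot`, exact algebra) a root `z₀` of `p(z₀) = T_k + log β`,
   `T_k = ±(k+1)^d 2πi`, with `‖z₀‖ ≍ k` and `Re z₀ ≤ -(3/16)(k+1)‖ω‖`;
2. (`exists_expPoint_near_root`, this file) a genuine solution `z` of `e^{z} = q(e^{p(z)})` with
   `‖z - z₀‖ ≤ 2/(d‖a‖)` — a TWO-variable contraction (`ExpDominant.exists_exp_eq_one_add`,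
   `n = 2`, `ε = 1/48`) in the unknowns `(v₀, v₁)`: `z = z₀ e^{v₀/(d a z₀^d)}`,
   `τ = e^{z/μ + η₀ - v₁/μ}` (`e^{μ η₀} = κ⁻¹`), equations `e^{v₀} = e^{-E}(1 + τ)`
   (`E = p(z) - p(z₀) - v₀`, `‖E‖ ≤ 1/400`) and `e^{v₁} = Q_μ(τ)/κ`; then
   `e^{p(z)} = β(1 + τ)` and `q(β(1+τ)) = τ^μ Q_μ(τ) = e^{z} κ⁻¹ e^{-v₁} Q_μ(τ) = e^{z}`.
   The point: the smallness of `τ` is built into its parametrisation, so no condition on the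
   size of the Taylor remainder of `q` at `β` is needed, and multiple roots cost nothing.
3. Along the sequence, `w_j = e^{p(z_j)}` satisfies `‖w_j - β‖ ≤ ‖β‖ e^{(Re z_j + δ)/μ + O(1)}`,
   super-polynomially small against `‖z_j‖`; the SHIFTED Liouville elimination
   `unprojectedDense_graphPolySurface_of_seq_at` (pull back `F` along
   `(z, p(z), q(u + β), u + β)` and apply `eq_zero_of_eval₂_eq_zero_of_superdecay` to `u = w - β`)
   gives `I(S ∩ Γ_exp) = I(S)`.
4. If `q` has no nonzero root but is non-constant, then `q = c X^m` (`m ≥ 1`) and the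
   exponential points are EXACT roots of the polynomial equations `m p(z) - z = -T_k - log c`
   (`exists_monomialSeq`, again via `exists_alRoot` for `m p - X`), with `w_j = e^{p(z_j)} → 0`
   super-polynomially; the unshifted elimination of `EACDensityFamilies` concludes.

## Contents

* Part 1 — `gpSymbAt`, `gpPullbackAt`, `mmEval_gpPullbackAt`,
  `unprojectedDense_graphPolySurface_of_seq_at` (elimination at a root `β`).
* Part 2 — `exists_expPoint_near_root` (step 2 at a root of multiplicity `μ`).
* Part 3 — `exists_rootSeq`, `exists_monomialSeq` (the escape sequences).
* Part 4 — `unprojectedDense_graphPolySurface_of_root`, `…_of_monomial`,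
  `…_of_natDegree_pos`, `unprojectedDensityQuestion_instance_crossed`, three examples.

## Honest framing

* Together with `EACDensityFamilies` (constant `q = c ≠ 0` under the criterion
  `Re(a_d (σ i)^d) < 0`) and `EACDensityAligned`, the crossed/aligned graph families are now
  decided except for: constant fibres `q = c` when the criterion fails (e.g.
  `{x₁ = x₀³, y₀ = 1}`, where `|e^{p(z)}| = 1` along the exponential points — an oscillatory
  regime), lines of real irrational slope, and of course Mantova–Masser's question for a GENERAL
  surface of case (dim-pi-S-1-free), which stays OPEN [MantovaMasser2023]. We decide instances;
  we do not claim the general question.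
* These are modest rungs of exponential-algebraic closedness for explicit surfaces in
  `ℂ² × (ℂˣ)²`; `EC(3,2)` and Zilber's conjecture remain OPEN; nothing here bears on Schanuel's
  conjecture (and EAC does not imply SC). The solvability engine is the tree's contraction lemma
  `ExpDominant.exists_exp_eq_one_add` [DaquinoFornasieroTerzo2017, Lemma 2.2 for the classical
  one-variable statement]; density of exponential points for varieties that "escape to infinity
  along a torus direction" is in the spirit of [Gallinaro2022, Thm 8.8 (arXiv:2203.13767)] and
  [AslanyanGallinaro2024, Rem. 3.5], but the surfaces here are not of the split form `L × W`
  treated there, and the statements below are proved from first principles.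
-/

noncomputable section

namespace Literature.ModelTheory.Zilber

open Filter Topology MvPolynomial Complex
open Literature.NumberTheory.Transcendental Literature.ModelTheory.ExponentialFields

variable (p q : Polynomial ℂ)

/-! ### Part 1 — Liouville elimination at a root `β` of `q` -/

section Elimination

/-- The symbolic parametrisation of `S_{p,q}` centred at `y₁ = β`, in `ℂ[z][u]`:
`x₀ ↦ z`, `x₁ ↦ p(z)`, `y₀ ↦ q(u + β)`, `y₁ ↦ u + β`. [folklore] -/
def gpSymbAt (β : ℂ) : Fin 2 ⊕ Fin 2 → Polynomial (Polynomial ℂ) :=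
  Sum.elim ![Polynomial.C Polynomial.X, Polynomial.C p]
    ![(q.comp (Polynomial.X + Polynomial.C β)).map Polynomial.C,
      Polynomial.X + Polynomial.C (Polynomial.C β)]

/-- Pull-back of `F ∈ ℂ[x₀, x₁, y₀, y₁]` to `ℂ[z][u]` along `gpSymbAt`. [folklore] -/
def gpPullbackAt (β : ℂ) (F : MvPolynomial (Fin 2 ⊕ Fin 2) ℂ) : Polynomial (Polynomial ℂ) :=
  eval₂Hom (Polynomial.C.comp Polynomial.C) (gpSymbAt p q β) F

/-- `mmEval u w` on the symbols `gpSymbAt` gives the coordinates of `gpParam p q u (w + β)`.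
[folklore] -/
theorem mmEval_gpSymbAt (β u w : ℂ) :
    (fun i => mmEval u w (gpSymbAt p q β i)) = gpParam p q u (w + β) := by
  funext i
  rcases i with i | i <;> fin_cases i <;> simp [gpSymbAt, gpParam, Polynomial.eval_comp]

/-- The shifted pull-back evaluates to `F` on the parametrised point. [folklore] -/
theorem mmEval_gpPullbackAt (β : ℂ) (F : MvPolynomial (Fin 2 ⊕ Fin 2) ℂ) (u w : ℂ) :
    mmEval u w (gpPullbackAt p q β F) = MvPolynomial.eval (gpParam p q u (w + β)) F := by
  rw [gpPullbackAt, ← RingHom.comp_apply, MvPolynomial.comp_eval₂Hom, mmEval_comp_C,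
    mmEval_gpSymbAt]
  rfl

/-- **Abstract density criterion at a root** (Liouville elimination, shifted). If `S_{p,q}`
carries exponential points `(z_k, p(z_k), q(w_k), w_k)` with `‖z_k‖ → ∞`, `w_k ≠ β` and
`‖w_k - β‖ ‖z_k‖^N → 0` for every `N`, then `I(S_{p,q} ∩ Γ_exp) = I(S_{p,q})`.
(new in this file) [folklore] -/
theorem unprojectedDense_graphPolySurface_of_seq_at (β : ℂ) (z w : ℕ → ℂ)
    (hz : Tendsto (fun k => ‖z k‖) atTop atTop) (hw : ∀ k, w k ≠ β)
    (hdec : ∀ N : ℕ, Tendsto (fun k => ‖w k - β‖ * ‖z k‖ ^ N) atTop (𝓝 0))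
    (hexp₁ : ∀ k, exp (z k) = q.eval (w k)) (hexp₂ : ∀ k, exp (p.eval (z k)) = w k) :
    UnprojectedDense (graphPolySurface p q) := by
  refine le_antisymm ?_ (vanishingIdeal_anti_mono Set.inter_subset_left)
  intro F hF
  have hG0 : gpPullbackAt p q β F = 0 := by
    refine eq_zero_of_eval₂_eq_zero_of_superdecay (gpPullbackAt p q β F) z (fun k => w k - β) hz
      (fun k => sub_ne_zero.mpr (hw k)) hdec fun k => ?_
    rw [← mmEval_eq_eval₂, mmEval_gpPullbackAt, sub_add_cancel, ← coe_aeval_eq_eval]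
    exact (mem_vanishingIdeal_iff.mp hF) _
      ⟨gpParam_mem p q _ _, gpParam_mem_expGraph p q (hexp₁ k) (hexp₂ k)⟩
  rw [mem_vanishingIdeal_iff]
  intro s hs
  have h := mmEval_gpPullbackAt p q β F (s (Sum.inl 0)) (s (Sum.inr 1) - β)
  rw [hG0, map_zero, sub_add_cancel, ← eq_gpParam_of_mem p q hs] at h
  simpa [coe_aeval_eq_eval] using h.symm

end Elimination

/-! ### Part 2 — from an exact root of `p(z₀) = T + log β` to an exponential point near a root
`β` of `q` of multiplicity `μ` (two-variable contraction) -/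

section Analysis

variable {p q}

/-- `Re(μ⁻¹ w) = μ⁻¹ Re w` for `μ ∈ ℕ`. [folklore] -/
theorem re_inv_natCast_mul (μ : ℕ) (w : ℂ) : (((μ : ℂ))⁻¹ * w).re = (μ : ℝ)⁻¹ * w.re := by
  have : ((μ : ℂ))⁻¹ = (((μ : ℝ)⁻¹ : ℝ) : ℂ) := by push_cast; rfl
  rw [this, Complex.re_ofReal_mul]

/-- **Step 2 at a root.** Let `p(z₀) = T + c₀` with `e^{T} = 1`, `e^{c₀} = β`, `deg p = d ≥ 2`,
leading coefficient `a`, and let `q(β(1+t)) = t^μ Q_μ(t)` with `μ ≥ 1`, `κ = Q_μ(0) ≠ 0`,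
`e^{μ η₀} = κ⁻¹`. If `z₀` is large (as in `exists_expPoint_near`) and
`ρ = e^{(Re z₀ + δ)/μ + Re η₀ + 1/μ}` (`δ = 2/(d‖a‖)`) satisfies `400 ρ ≤ 1` and
`96 (Σ‖Q_μ,i‖) ρ ≤ ‖κ‖`, then there is `z` with `‖z - z₀‖ ≤ δ`, **`e^{z} = q(e^{p(z)})`**,
`e^{p(z)} ≠ β` and `‖e^{p(z)} - β‖ ≤ ‖β‖ ρ`. Proof: with `T' = a z₀^d`, `z(v) = z₀ e^{v₀/(dT')}`,
`E(v) = p(z(v)) - p(z₀) - v₀` (`‖E‖ ≤ 1/400`), `τ(v) = e^{z(v)/μ + η₀ - v₁/μ}` (`‖τ‖ ≤ ρ`), solve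
`e^{v₀} = e^{-E(v)} (1 + τ(v))`, `e^{v₁} = Q_μ(τ(v))/κ` by `ExpDominant.exists_exp_eq_one_add`
(`n = 2`, `ε = 1/48`); then `e^{p(z(v))} = β e^{v₀ + E(v)} = β (1 + τ)` and
`q(β(1+τ)) = τ^μ Q_μ(τ) = e^{z(v)} κ⁻¹ e^{-v₁} Q_μ(τ) = e^{z(v)}`. (new in this file) [folklore] -/
theorem exists_expPoint_near_root (hd : 2 ≤ p.natDegree) (β : ℂ) (μ : ℕ) (hμ : 1 ≤ μ)
    (Qμ : Polynomial ℂ) (hfac : ∀ t : ℂ, q.eval (β * (1 + t)) = t ^ μ * Qμ.eval t)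
    (hκ : Qμ.eval 0 ≠ 0) (η₀ : ℂ) (hη₀ : exp ((μ : ℂ) * η₀) = (Qμ.eval 0)⁻¹)
    (z₀ T c₀ : ℂ) (hroot : p.eval z₀ = T + c₀) (hT : exp T = 1) (hc₀ : exp c₀ = β)
    (hz1 : 1 ≤ ‖z₀‖) (haz : 1 ≤ ‖p.leadingCoeff‖ * ‖z₀‖)
    (hE : 400 * ((1 + 2 * 3 ^ (p.natDegree - 2) * coeffNormSum p.eraseLead) / ‖p.leadingCoeff‖)
      ≤ ‖z₀‖)
    (hτ₁ : 400 * Real.exp ((z₀.re + 2 / (p.natDegree * ‖p.leadingCoeff‖)) / μ + η₀.re + 1 / μ)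
      ≤ 1)
    (hτ₂ : 96 * coeffNormSum Qμ *
      Real.exp ((z₀.re + 2 / (p.natDegree * ‖p.leadingCoeff‖)) / μ + η₀.re + 1 / μ) ≤
        ‖Qμ.eval 0‖) :
    ∃ z : ℂ, exp z = q.eval (exp (p.eval z)) ∧
      ‖z - z₀‖ ≤ 2 / (p.natDegree * ‖p.leadingCoeff‖) ∧ exp (p.eval z) ≠ β ∧
      ‖exp (p.eval z) - β‖ ≤ ‖β‖ *
        Real.exp ((z₀.re + 2 / (p.natDegree * ‖p.leadingCoeff‖)) / μ + η₀.re + 1 / μ) := by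
  -- notation
  set d : ℕ := p.natDegree with hd_def
  set a : ℂ := p.leadingCoeff with ha_def
  set ℓ : Polynomial ℂ := p.eraseLead with hℓ_def
  set R : ℝ := ‖z₀‖ with hR_def
  have hd1 : 1 ≤ d := le_trans (by norm_num) hd
  have hdR : (1 : ℝ) ≤ d := by exact_mod_cast hd1
  have hdC : (d : ℂ) ≠ 0 := Nat.cast_ne_zero.mpr (by omega)
  have ha_pos : 0 < ‖a‖ := by
    rcases (norm_nonneg a).eq_or_lt with h | h
    · rw [← h, zero_mul] at haz; linarith
    · exact h
  have ha0 : a ≠ 0 := norm_pos_iff.mp ha_pos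
  have hR1 : 1 ≤ R := hz1
  have hR0 : 0 < R := by linarith
  have hz0 : z₀ ≠ 0 := norm_pos_iff.mp hR0
  set T' : ℂ := a * z₀ ^ d with hT'_def
  have hT'norm : ‖T'‖ = ‖a‖ * R ^ d := by rw [hT'_def, norm_mul, norm_pow]
  have hRd : R ≤ R ^ d := le_self_pow₀ hR1 (by omega)
  have hT'1 : 1 ≤ ‖T'‖ := by
    rw [hT'norm]
    exact haz.trans (mul_le_mul_of_nonneg_left hRd ha_pos.le)
  have hT'pos : 0 < ‖T'‖ := by linarith
  have hT'0 : T' ≠ 0 := norm_pos_iff.mp hT'pos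
  set δ : ℝ := 2 / (d * ‖a‖) with hδ_def
  have hδ_pos : 0 < δ := by positivity
  -- the maps
  set xx : (Fin 2 → ℂ) → ℂ := fun v => v 0 / (d * T') with hxx
  set zz : (Fin 2 → ℂ) → ℂ := fun v => z₀ * exp (xx v) with hzz
  set E : (Fin 2 → ℂ) → ℂ := fun v => p.eval (zz v) - p.eval z₀ - v 0 with hE_def
  -- differentiability
  have hxx_d : Differentiable ℂ xx := by
    show Differentiable ℂ (fun v : Fin 2 → ℂ => v 0 / ((d : ℂ) * T'))
    simp_rw [div_eq_mul_inv]
    exact (differentiable_apply (𝕜 := ℂ) (0 : Fin 2)).mul_const _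
  have hzz_d : Differentiable ℂ zz := (differentiable_const z₀).mul hxx_d.cexp
  have hE_d : Differentiable ℂ E :=
    (((Polynomial.differentiable p).comp hzz_d).sub (differentiable_const _)).sub
      (differentiable_apply 0)
  -- estimates for `‖v 0‖ ≤ 1`
  have hxx_le : ∀ v : Fin 2 → ℂ, ‖v 0‖ ≤ 1 → ‖xx v‖ ≤ ‖v 0‖ / (d * ‖T'‖) := by
    intro v hv
    show ‖v 0 / (d * T')‖ ≤ ‖v 0‖ / (d * ‖T'‖)
    rw [norm_div, norm_mul, Complex.norm_natCast]
  have hxx_one : ∀ v : Fin 2 → ℂ, ‖v 0‖ ≤ 1 → ‖xx v‖ ≤ 1 := by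
    intro v hv
    refine (hxx_le v hv).trans ?_
    rw [div_le_one (by positivity)]
    nlinarith
  have hdiff : ∀ v : Fin 2 → ℂ, ‖v 0‖ ≤ 1 → ‖zz v - z₀‖ ≤ 2 * R / (d * ‖T'‖) := by
    intro v hv
    have h1 : zz v - z₀ = z₀ * (exp (xx v) - 1) := by simp only [hzz]; ring
    rw [h1, norm_mul]
    calc ‖z₀‖ * ‖exp (xx v) - 1‖ ≤ R * (2 * ‖xx v‖) :=
          mul_le_mul_of_nonneg_left (Complex.norm_exp_sub_one_le (hxx_one v hv)) (norm_nonneg _)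
      _ ≤ R * (2 * (1 / (d * ‖T'‖))) := by
          refine mul_le_mul_of_nonneg_left (mul_le_mul_of_nonneg_left ?_ (by norm_num)) hR0.le
          exact (hxx_le v hv).trans (div_le_div_of_nonneg_right hv (by positivity))
      _ = 2 * R / (d * ‖T'‖) := by ring
  have hRT : 2 * R / (d * ‖T'‖) ≤ δ := by
    rw [hδ_def, hT'norm, div_le_div_iff₀ (by positivity) (by positivity)]
    have : R * ‖a‖ ≤ ‖a‖ * R ^ d := by rw [mul_comm]; exact mul_le_mul_of_nonneg_left hRd ha_pos.le
    nlinarith [this, hdR]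
  have hdiffδ : ∀ v : Fin 2 → ℂ, ‖v 0‖ ≤ 1 → ‖zz v - z₀‖ ≤ δ := fun v hv => (hdiff v hv).trans hRT
  have hzz3 : ∀ v : Fin 2 → ℂ, ‖v 0‖ ≤ 1 → ‖zz v‖ ≤ 3 * R := by
    intro v hv
    show ‖z₀ * exp (xx v)‖ ≤ 3 * R
    rw [norm_mul, mul_comm]
    exact mul_le_mul_of_nonneg_right (norm_exp_le_three (hxx_one v hv)) (norm_nonneg _)
  have hre : ∀ v : Fin 2 → ℂ, ‖v 0‖ ≤ 1 → (zz v).re ≤ z₀.re + δ := by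
    intro v hv
    have h1 : (zz v).re = z₀.re + (zz v - z₀).re := by simp
    rw [h1]
    exact add_le_add le_rfl ((re_le_norm _).trans (hdiffδ v hv))
  -- the remainder `E`
  have hE_eq : ∀ v : Fin 2 → ℂ, E v = T' * (exp (v 0 / T') - 1 - v 0 / T') +
      (ℓ.eval (zz v) - ℓ.eval z₀) := by
    intro v
    have hpow : (zz v) ^ d = z₀ ^ d * exp (v 0 / T') := by
      show (z₀ * exp (v 0 / (d * T'))) ^ d = z₀ ^ d * exp (v 0 / T')
      rw [mul_pow, ← Complex.exp_nat_mul]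
      congr 2
      field_simp
    show p.eval (zz v) - p.eval z₀ - v 0 = _
    rw [eval_eq_eraseLead_add p (zz v), eval_eq_eraseLead_add p z₀, hpow]
    have : T' * (v 0 / T') = v 0 := mul_div_cancel₀ _ hT'0
    rw [← ha_def, ← hℓ_def, ← hd_def]
    linear_combination this
  have hEle : ∀ v : Fin 2 → ℂ, ‖v 0‖ ≤ 1 → ‖E v‖ ≤ 1 / 400 := by
    intro v hv
    have hy : ‖v 0 / T'‖ ≤ 1 := by
      rw [norm_div, div_le_one hT'pos]; exact hv.trans hT'1
    have h1 : ‖T' * (exp (v 0 / T') - 1 - v 0 / T')‖ ≤ 1 / (‖a‖ * R) := by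
      rw [norm_mul]
      calc ‖T'‖ * ‖exp (v 0 / T') - 1 - v 0 / T'‖ ≤ ‖T'‖ * ‖v 0 / T'‖ ^ 2 :=
            mul_le_mul_of_nonneg_left (Complex.norm_exp_sub_one_sub_id_le hy) (norm_nonneg _)
        _ = ‖v 0‖ ^ 2 / ‖T'‖ := by rw [norm_div]; field_simp
        _ ≤ 1 / ‖T'‖ := by
            refine div_le_div_of_nonneg_right ?_ hT'pos.le
            nlinarith [norm_nonneg (v 0)]
        _ ≤ 1 / (‖a‖ * R) := by
            rw [hT'norm]
            exact one_div_le_one_div_of_le (by positivity) (mul_le_mul_of_nonneg_left hRd ha_pos.le)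
    have hM : (1 : ℝ) ≤ 3 * R := by linarith
    have hℓdeg : ℓ.natDegree ≤ (d - 2) + 1 := by
      have := Polynomial.eraseLead_natDegree_le p
      rw [← hℓ_def, ← hd_def] at this
      omega
    have h2 : ‖ℓ.eval (zz v) - ℓ.eval z₀‖ ≤
        coeffNormSum ℓ * ((d - 2 : ℕ) + 1) * (3 * R) ^ (d - 2) * ‖zz v - z₀‖ :=
      norm_eval_sub_eval_le ℓ hM (hzz3 v hv) (by linarith) hℓdeg
    have h3 : coeffNormSum ℓ * ((d - 2 : ℕ) + 1) * (3 * R) ^ (d - 2) * ‖zz v - z₀‖ ≤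
        2 * 3 ^ (d - 2) * coeffNormSum ℓ / (‖a‖ * R) := by
      have hcast : ((d - 2 : ℕ) : ℝ) + 1 ≤ d := by
        rw [Nat.cast_sub hd]; push_cast; linarith
      have hRpow : R ^ d = R ^ (d - 2) * R * R := by
        rw [← pow_succ, ← pow_succ]; congr 1; omega
      calc coeffNormSum ℓ * ((d - 2 : ℕ) + 1) * (3 * R) ^ (d - 2) * ‖zz v - z₀‖
          ≤ coeffNormSum ℓ * d * (3 * R) ^ (d - 2) * (2 * R / (d * ‖T'‖)) := by
            refine mul_le_mul ?_ (hdiff v hv) (norm_nonneg _)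
              (by have := coeffNormSum_nonneg ℓ; positivity)
            refine mul_le_mul_of_nonneg_right ?_ (by positivity)
            exact mul_le_mul_of_nonneg_left hcast (coeffNormSum_nonneg ℓ)
        _ = 2 * 3 ^ (d - 2) * coeffNormSum ℓ / (‖a‖ * R) := by
            rw [hT'norm, hRpow, mul_pow]
            field_simp
    calc ‖E v‖ ≤ ‖T' * (exp (v 0 / T') - 1 - v 0 / T')‖ + ‖ℓ.eval (zz v) - ℓ.eval z₀‖ := by
          rw [hE_eq]; exact norm_add_le _ _
      _ ≤ 1 / (‖a‖ * R) + 2 * 3 ^ (d - 2) * coeffNormSum ℓ / (‖a‖ * R) :=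
          add_le_add h1 (h2.trans h3)
      _ = (1 + 2 * 3 ^ (d - 2) * coeffNormSum ℓ) / ‖a‖ / R := by
          field_simp
      _ ≤ 1 / 400 := by
          rw [div_le_iff₀ hR0]
          linarith
  -- the two correction terms are small on the unit polydisc
  have hexpzz : ∀ v : Fin 2 → ℂ, ‖v 0‖ ≤ 1 → ‖exp (zz v)‖ ≤ Real.exp (z₀.re + δ) := by
    intro v hv
    rw [Complex.norm_exp]
    exact Real.exp_le_exp.mpr (hre v hv)
  -- the root data
  set κ : ℂ := Qμ.eval 0 with hκ_def
  set ρ : ℝ := Real.exp ((z₀.re + δ) / μ + η₀.re + 1 / μ) with hρ_def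
  have hρ400 : ρ ≤ 1 / 400 := by linarith
  have hκpos : 0 < ‖κ‖ := norm_pos_iff.mpr hκ
  have hμR : (1 : ℝ) ≤ μ := by exact_mod_cast hμ
  have hμpos : (0 : ℝ) < μ := by linarith
  have hμC : (μ : ℂ) ≠ 0 := Nat.cast_ne_zero.mpr (by omega)
  have hβ0 : β ≠ 0 := by rw [← hc₀]; exact exp_ne_zero _
  set τ : (Fin 2 → ℂ) → ℂ := fun v => exp (((μ : ℂ))⁻¹ * zz v + η₀ - ((μ : ℂ))⁻¹ * v 1) with hτ
  set g₀ : (Fin 2 → ℂ) → ℂ := fun v => exp (-E v) * (1 + τ v) - 1 with hg₀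
  set g₁ : (Fin 2 → ℂ) → ℂ := fun v => Qμ.eval (τ v) * κ⁻¹ - 1 with hg₁
  have hτ_d : Differentiable ℂ τ :=
    ((((differentiable_const _).mul hzz_d).add (differentiable_const _)).sub
      ((differentiable_const _).mul (differentiable_apply 1))).cexp
  have hg₀_d : Differentiable ℂ g₀ :=
    ((hE_d.neg.cexp).mul ((differentiable_const _).add hτ_d)).sub (differentiable_const _)
  have hg₁_d : Differentiable ℂ g₁ :=
    ((((Polynomial.differentiable Qμ).comp hτ_d)).mul_const _).sub (differentiable_const _)
  -- `‖τ‖ ≤ ρ`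
  have hτle : ∀ v : Fin 2 → ℂ, ‖v 0‖ ≤ 1 → ‖v 1‖ ≤ 1 → ‖τ v‖ ≤ ρ := by
    intro v hv0 hv1
    show ‖exp (((μ : ℂ))⁻¹ * zz v + η₀ - ((μ : ℂ))⁻¹ * v 1)‖ ≤ ρ
    rw [Complex.norm_exp, hρ_def]
    refine Real.exp_le_exp.mpr ?_
    rw [Complex.sub_re, Complex.add_re, re_inv_natCast_mul, re_inv_natCast_mul]
    have hμinv : (0 : ℝ) ≤ (μ : ℝ)⁻¹ := inv_nonneg.mpr hμpos.le
    have h1 : (μ : ℝ)⁻¹ * (zz v).re ≤ (z₀.re + δ) / μ := by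
      rw [div_eq_inv_mul]
      exact mul_le_mul_of_nonneg_left (hre v hv0) hμinv
    have h2 : -((μ : ℝ)⁻¹ * (v 1).re) ≤ 1 / μ := by
      rw [one_div, ← mul_neg]
      have h3 : -(v 1).re ≤ 1 := by
        have := Complex.abs_re_le_norm (v 1)
        have := neg_abs_le (v 1).re
        linarith [le_abs_self (v 1).re, neg_le_abs (v 1).re]
      calc (μ : ℝ)⁻¹ * -(v 1).re ≤ (μ : ℝ)⁻¹ * 1 := mul_le_mul_of_nonneg_left h3 hμinv
        _ = (μ : ℝ)⁻¹ := mul_one _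
    linarith
  have hτ0le : ∀ v : Fin 2 → ℂ, ‖v 0‖ ≤ 1 → ‖v 1‖ ≤ 1 → ‖τ v‖ ≤ 1 / 400 :=
    fun v hv0 hv1 => (hτle v hv0 hv1).trans hρ400
  -- `Q_μ(τ)` stays near `κ`
  have hQle : ∀ v : Fin 2 → ℂ, ‖v 0‖ ≤ 1 → ‖v 1‖ ≤ 1 → ‖Qμ.eval (τ v) - κ‖ ≤ ‖κ‖ / 96 := by
    intro v hv0 hv1
    have hτ1 : ‖τ v‖ ≤ 1 := (hτ0le v hv0 hv1).trans (by norm_num)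
    calc ‖Qμ.eval (τ v) - κ‖ ≤ coeffNormSum Qμ * ‖τ v‖ := norm_eval_sub_eval_zero_le Qμ hτ1
      _ ≤ coeffNormSum Qμ * ρ := mul_le_mul_of_nonneg_left (hτle v hv0 hv1) (coeffNormSum_nonneg _)
      _ ≤ ‖κ‖ / 96 := by linarith
  have hg₁le : ∀ v : Fin 2 → ℂ, ‖v 0‖ ≤ 1 → ‖v 1‖ ≤ 1 → ‖g₁ v‖ ≤ 1 / 48 := by
    intro v hv0 hv1
    have h1 : g₁ v = (Qμ.eval (τ v) - κ) / κ := by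
      simp only [hg₁]; field_simp
    rw [h1, norm_div, div_le_iff₀ hκpos]
    have := hQle v hv0 hv1
    linarith
  have hg₀le : ∀ v : Fin 2 → ℂ, ‖v 0‖ ≤ 1 → ‖v 1‖ ≤ 1 → ‖g₀ v‖ ≤ 1 / 48 := by
    intro v hv0 hv1
    have h1 : g₀ v = (exp (-E v) - 1) * (1 + τ v) + τ v := by simp only [hg₀]; ring
    have hE1 : ‖-E v‖ ≤ 1 := by rw [norm_neg]; exact (hEle v hv0).trans (by norm_num)
    have h2 : ‖exp (-E v) - 1‖ ≤ 2 * ‖E v‖ := by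
      have := Complex.norm_exp_sub_one_le hE1; rwa [norm_neg] at this
    have hτ' := hτ0le v hv0 hv1
    have hE' := hEle v hv0
    rw [h1]
    calc ‖(exp (-E v) - 1) * (1 + τ v) + τ v‖
        ≤ ‖exp (-E v) - 1‖ * ‖1 + τ v‖ + ‖τ v‖ := by
          rw [← norm_mul]; exact norm_add_le _ _
      _ ≤ (2 * (1 / 400)) * (1 + 1 / 400) + 1 / 400 := by
          have h3 : ‖1 + τ v‖ ≤ 1 + 1 / 400 :=
            (norm_add_le _ _).trans (by rw [norm_one]; linarith)
          have h4 : ‖exp (-E v) - 1‖ ≤ 2 * (1 / 400) := h2.trans (by linarith)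
          exact add_le_add (mul_le_mul h4 h3 (norm_nonneg _) (by norm_num)) hτ'
      _ ≤ 1 / 48 := by norm_num
  -- apply the two-variable contraction
  have hball : ∀ v ∈ Metric.ball (0 : Fin 2 → ℂ) 1, ∀ i, ‖v i‖ ≤ 1 := by
    intro v hv i
    rw [Metric.mem_ball, dist_zero_right] at hv
    exact ((norm_le_pi_norm v i).trans hv.le)
  obtain ⟨ξ, hξ, hsol⟩ := ExpDominant.exists_exp_eq_one_add (n := 2) (ε := 1 / 48) ![g₀, g₁]
    (by norm_num) (by norm_num)
    (by
      intro j; fin_cases j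
      · exact hg₀_d.differentiableOn
      · exact hg₁_d.differentiableOn)
    (by
      intro j v hv; fin_cases j
      · exact hg₀le v (hball v hv 0) (hball v hv 1)
      · exact hg₁le v (hball v hv 0) (hball v hv 1))
  have hξ0 : ‖ξ 0‖ ≤ 1 := (norm_le_pi_norm ξ 0).trans (hξ.trans (by norm_num))
  have hξ1 : ‖ξ 1‖ ≤ 1 := (norm_le_pi_norm ξ 1).trans (hξ.trans (by norm_num))
  have h0 : exp (ξ 0) = exp (-E ξ) * (1 + τ ξ) := by
    have := hsol 0
    simp only [Matrix.cons_val_zero] at this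
    rw [this]
    show 1 + (exp (-E ξ) * (1 + τ ξ) - 1) = _
    ring
  have h1 : exp (ξ 1) * κ = Qμ.eval (τ ξ) := by
    have := hsol 1
    simp only [Matrix.cons_val_one, Matrix.cons_val_zero] at this
    rw [this]
    show (1 + (Qμ.eval (τ ξ) * κ⁻¹ - 1)) * κ = _
    field_simp
    ring
  -- the exponential of `p(z(ξ))`
  have hsum : exp (ξ 0 + E ξ) = 1 + τ ξ := by
    rw [Complex.exp_add, h0, mul_comm (exp (-E ξ)) _, mul_assoc, ← Complex.exp_add,
      neg_add_cancel, Complex.exp_zero, mul_one]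
  have hpzz : p.eval (zz ξ) = T + c₀ + (ξ 0 + E ξ) := by
    have : E ξ = p.eval (zz ξ) - p.eval z₀ - ξ 0 := rfl
    linear_combination hroot - this
  have hexp_p : exp (p.eval (zz ξ)) = β * (1 + τ ξ) := by
    rw [hpzz, Complex.exp_add, Complex.exp_add, hT, hc₀, hsum, one_mul]
  have hτpow : τ ξ ^ μ * Qμ.eval (τ ξ) = exp (zz ξ) := by
    have hpow : τ ξ ^ μ = exp (zz ξ) * κ⁻¹ * (exp (ξ 1))⁻¹ := by
      show exp (((μ : ℂ))⁻¹ * zz ξ + η₀ - ((μ : ℂ))⁻¹ * ξ 1) ^ μ = _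
      rw [← Complex.exp_nat_mul,
        (show (μ : ℂ) * (((μ : ℂ))⁻¹ * zz ξ + η₀ - ((μ : ℂ))⁻¹ * ξ 1) =
          zz ξ + (μ : ℂ) * η₀ + -(ξ 1) by field_simp; ring),
        Complex.exp_add, Complex.exp_add, hη₀, Complex.exp_neg]
    rw [hpow, ← h1]
    have he : exp (ξ 1) ≠ 0 := exp_ne_zero _
    field_simp
  have hτne : τ ξ ≠ 0 := exp_ne_zero _
  refine ⟨zz ξ, ?_, hdiffδ ξ hξ0, ?_, ?_⟩
  · rw [hexp_p, hfac, hτpow]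
  · rw [hexp_p]
    intro h
    apply hτne
    have h' : β * τ ξ = 0 := by linear_combination h
    exact (mul_eq_zero.mp h').resolve_left hβ0
  · rw [hexp_p, (show β * (1 + τ ξ) - β = β * τ ξ by ring), norm_mul]
    exact mul_le_mul_of_nonneg_left (hτle ξ hξ0 hξ1) (norm_nonneg _)

end Analysis

/-! ### Part 3 — the escape sequences -/

section Supply

variable {p q}

/-- **The escape sequence at a nonzero root `β` of `q`** (`deg p ≥ 2`; `q(β(1+t)) = t^μ Q_μ(t)`,
`μ ≥ 1`, `Q_μ(0) ≠ 0`; a root direction `ω` of `p`): exponential points of `S_{p,q}`,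
`e^{z_j} = q(w_j)`, `w_j = e^{p(z_j)}`, with `‖z_j‖ → ∞` and `w_j - β` decaying super-polynomially
against `‖z_j‖` (stage `k`: `exists_alRoot` for `p(z₀) = T_k + log β`, then
`exists_expPoint_near_root`). (new in this file) [folklore] -/
theorem exists_rootSeq (hd : 2 ≤ p.natDegree) (β : ℂ) (hβ : β ≠ 0) (μ : ℕ) (hμ : 1 ≤ μ)
    (Qμ : Polynomial ℂ) (hfac : ∀ t : ℂ, q.eval (β * (1 + t)) = t ^ μ * Qμ.eval t)
    (hκ : Qμ.eval 0 ≠ 0) (ω : ℂ) (s : ℤ) (hs : s = 1 ∨ s = -1)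
    (hω : p.leadingCoeff * ω ^ p.natDegree = 2 * Real.pi * I * s) (hre : ω.re ≤ -(‖ω‖ / 2)) :
    ∃ z w : ℕ → ℂ, Tendsto (fun j => ‖z j‖) atTop atTop ∧ (∀ j, w j ≠ β) ∧
      (∀ N : ℕ, Tendsto (fun j => ‖w j - β‖ * ‖z j‖ ^ N) atTop (𝓝 0)) ∧
      (∀ j, exp (z j) = q.eval (w j)) ∧ ∀ j, exp (p.eval (z j)) = w j := by
  set d : ℕ := p.natDegree with hd_def
  set a : ℂ := p.leadingCoeff with ha_def
  set ℓ : Polynomial ℂ := p.eraseLead with hℓ_def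
  set c₀ : ℂ := log β with hc₀_def
  have hc₀ : exp c₀ = β := exp_log hβ
  set κ : ℂ := Qμ.eval 0 with hκ_def
  set η₀ : ℂ := -log κ * ((μ : ℂ))⁻¹ with hη₀_def
  have hμC : (μ : ℂ) ≠ 0 := Nat.cast_ne_zero.mpr (by omega)
  have hη₀ : exp ((μ : ℂ) * η₀) = κ⁻¹ := by
    rw [hη₀_def, (show (μ : ℂ) * (-log κ * ((μ : ℂ))⁻¹) = -log κ by field_simp),
      Complex.exp_neg, exp_log hκ]
  have hd1 : 1 ≤ d := le_trans (by norm_num) hd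
  have hrhs : (2 * Real.pi * I * s : ℂ) ≠ 0 := by
    have hsC : (s : ℂ) ≠ 0 := by rcases hs with rfl | rfl <;> simp
    have hπ : (Real.pi : ℂ) ≠ 0 := Complex.ofReal_ne_zero.mpr Real.pi_pos.ne'
    simp [hsC, hπ, Complex.I_ne_zero]
  have hω0 : ω ≠ 0 := by
    rintro rfl
    rw [zero_pow (by omega), mul_zero] at hω
    exact hrhs hω.symm
  have ha0 : a ≠ 0 := by
    intro h
    rw [h, zero_mul] at hω
    exact hrhs hω.symm
  have hωpos : 0 < ‖ω‖ := norm_pos_iff.mpr hω0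
  have hapos : 0 < ‖a‖ := norm_pos_iff.mpr ha0
  have hμR : (1 : ℝ) ≤ μ := by exact_mod_cast hμ
  have hμpos : (0 : ℝ) < μ := by linarith
  -- constants
  set C₁ : ℝ := coeffNormSum ℓ * (3 * ‖ω‖ + 1) ^ (d - 1) + ‖c₀‖ with hC₁
  set C₂ : ℝ := 400 * ((1 + 2 * 3 ^ (d - 2) * coeffNormSum ℓ) / ‖a‖) with hC₂
  set δ : ℝ := 2 / (d * ‖a‖) with hδ
  set D : ℝ := η₀.re + 1 / μ with hD
  set B : ℝ := Real.log ‖β‖ with hB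
  have hδ0 : 0 ≤ δ := by positivity
  set L : ℕ → ℝ := fun k => ((k : ℝ) + 1) * ‖ω‖ with hL_def
  have hL : Tendsto L atTop atTop := (tendsto_natCast_add_atTop 1).atTop_mul_const hωpos
  -- the exponent `X_k = (-(3/16) L_k + δ)/μ + D` tends to `-∞`
  set X : ℕ → ℝ := fun k => (-((3 / 16) * L k) + δ) / μ + D with hX_def
  have hX : Tendsto X atTop atBot := by
    have h1 : Tendsto (fun k => -((3 / 16) * L k) + δ) atTop atBot :=
      tendsto_atBot_add_const_right _ δ
        (tendsto_neg_atTop_atBot.comp (hL.const_mul_atTop (by norm_num : (0 : ℝ) < 3 / 16)))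
    have h2 : Tendsto (fun k => (-((3 / 16) * L k) + δ) / μ) atTop atBot :=
      h1.atBot_div_const hμpos
    exact tendsto_atBot_add_const_right _ D h2
  have hexpX : Tendsto (fun k => Real.exp (X k)) atTop (𝓝 0) := Real.tendsto_exp_atBot.comp hX
  -- eventual conditions
  have hev₁ : ∀ᶠ k : ℕ in atTop, 32 * C₁ ≤ 2 * Real.pi * ((k : ℝ) + 1) :=
    ((tendsto_natCast_add_atTop 1).const_mul_atTop (by positivity : (0 : ℝ) < 2 * Real.pi)
      ).eventually_ge_atTop _
  have hev₂ : ∀ᶠ k : ℕ in atTop, 3 ≤ L k := hL.eventually_ge_atTop 3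
  have hev₃ : ∀ᶠ k : ℕ in atTop, 3 ≤ ‖a‖ * L k := (hL.const_mul_atTop hapos).eventually_ge_atTop 3
  have hev₄ : ∀ᶠ k : ℕ in atTop, 3 * C₂ ≤ L k := hL.eventually_ge_atTop _
  have hev₅ : ∀ᶠ k : ℕ in atTop, 400 * Real.exp (X k) ≤ 1 := by
    have h2 : Tendsto (fun k => 400 * Real.exp (X k)) atTop (𝓝 (400 * 0)) := hexpX.const_mul 400
    rw [mul_zero] at h2
    exact h2.eventually (ge_mem_nhds (by norm_num))
  have hev₆ : ∀ᶠ k : ℕ in atTop, 96 * coeffNormSum Qμ * Real.exp (X k) ≤ ‖κ‖ := by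
    have h2 : Tendsto (fun k => 96 * coeffNormSum Qμ * Real.exp (X k)) atTop
        (𝓝 (96 * coeffNormSum Qμ * 0)) := hexpX.const_mul _
    rw [mul_zero] at h2
    exact h2.eventually (ge_mem_nhds (norm_pos_iff.mpr hκ))
  have hev₇ : ∀ᶠ k : ℕ in atTop, 33 * δ + 32 * μ * (D + B) ≤ 3 * L k :=
    (hL.const_mul_atTop (by norm_num : (0 : ℝ) < 3)).eventually_ge_atTop _
  obtain ⟨K₀, hK₀⟩ :=
    eventually_atTop.1 (hev₁.and (hev₂.and (hev₃.and (hev₄.and (hev₅.and (hev₆.and hev₇))))))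
  -- solve at stage k = j + K₀
  have hsol : ∀ j : ℕ, ∃ z : ℂ, exp z = q.eval (exp (p.eval z)) ∧
      exp (p.eval z) ≠ β ∧ ‖exp (p.eval z) - β‖ ≤ Real.exp (X (j + K₀) + B) ∧
      L (j + K₀) / 3 - δ ≤ ‖z‖ ∧ ‖z‖ ≤ 3 * L (j + K₀) + δ := by
    intro j
    obtain ⟨h1, h2, h3, h4, h5, h6, h7⟩ := hK₀ (j + K₀) (Nat.le_add_left _ _)
    obtain ⟨z₀, hroot, hup, hlow, hre₀⟩ := exists_alRoot p hd ω s hs hω hre c₀ (j + K₀)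
      (by push_cast at h1 ⊢; linarith)
    have hLk : L (j + K₀) = (((j + K₀ : ℕ) : ℝ) + 1) * ‖ω‖ := rfl
    have hz1 : 1 ≤ ‖z₀‖ := by rw [hLk] at h2; linarith
    have haz : 1 ≤ ‖a‖ * ‖z₀‖ := by
      rw [hLk] at h3
      nlinarith [mul_le_mul_of_nonneg_left hlow hapos.le]
    have hEz : C₂ ≤ ‖z₀‖ := by rw [hLk] at h4; linarith
    have hre' : z₀.re + δ ≤ -((3 / 16) * L (j + K₀)) + δ := by rw [hLk]; linarith
    have hexple : Real.exp ((z₀.re + 2 / (d * ‖a‖)) / μ + η₀.re + 1 / μ) ≤ Real.exp (X (j + K₀)) := by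
      refine Real.exp_le_exp.mpr ?_
      show (z₀.re + δ) / μ + η₀.re + 1 / μ ≤ (-((3 / 16) * L (j + K₀)) + δ) / μ + D
      rw [hD]
      have := div_le_div_of_nonneg_right hre' hμpos.le
      linarith
    have hτ₁ : 400 * Real.exp ((z₀.re + 2 / (d * ‖a‖)) / μ + η₀.re + 1 / μ) ≤ 1 :=
      le_trans (mul_le_mul_of_nonneg_left hexple (by norm_num)) h5
    have hτ₂ : 96 * coeffNormSum Qμ *
        Real.exp ((z₀.re + 2 / (d * ‖a‖)) / μ + η₀.re + 1 / μ) ≤ ‖κ‖ :=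
      le_trans (mul_le_mul_of_nonneg_left hexple
        (by have := coeffNormSum_nonneg Qμ; positivity)) h6
    have hTexp : exp ((((j + K₀ + 1) ^ d * s : ℤ) : ℂ) * (2 * Real.pi * I)) = 1 :=
      Complex.exp_int_mul_two_pi_mul_I _
    obtain ⟨z, hz, hdist, hne, hwβ⟩ := exists_expPoint_near_root hd β μ hμ Qμ hfac hκ η₀ hη₀
      z₀ _ c₀ hroot hTexp hc₀ hz1 haz hEz hτ₁ hτ₂
    refine ⟨z, hz, hne, ?_, ?_, ?_⟩
    · refine hwβ.trans ?_
      have hβexp : Real.exp B = ‖β‖ := by rw [hB, Real.exp_log (norm_pos_iff.mpr hβ)]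
      calc ‖β‖ * Real.exp ((z₀.re + 2 / (d * ‖a‖)) / μ + η₀.re + 1 / μ)
          ≤ ‖β‖ * Real.exp (X (j + K₀)) := mul_le_mul_of_nonneg_left hexple (norm_nonneg _)
        _ = Real.exp (X (j + K₀) + B) := by rw [Real.exp_add (X (j + K₀)) B, hβexp, mul_comm]
    · have h := norm_sub_norm_le z₀ z
      rw [norm_sub_rev] at h
      rw [hLk]; linarith
    · have h := norm_le_insert' z z₀
      rw [hLk]; linarith
  choose z hz using hsol
  refine ⟨z, fun j => exp (p.eval (z j)), ?_, fun j => (hz j).2.1, ?_, fun j => (hz j).1,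
    fun j => rfl⟩
  · -- ‖z_j‖ → ∞
    refine tendsto_norm_atTop_of_le (hL.comp (tendsto_add_atTop_nat K₀)) (a := 1 / 3) (b := δ)
      (by norm_num) fun j => ?_
    have := (hz j).2.2.2.1
    simp only [Function.comp_apply]
    linarith
  · -- super-polynomial decay with scale `K_j = -(X_{j+K₀} + B)`
    intro N
    have hK : Tendsto (fun j => -(X (j + K₀) + B)) atTop atTop :=
      tendsto_neg_atBot_atTop.comp
        (tendsto_atBot_add_const_right _ B (hX.comp (tendsto_add_atTop_nat K₀)))
    refine superdecay_of_le hK (A := 32 * μ) (fun j => ?_) (fun j => ?_) N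
    · obtain ⟨-, -, -, -, -, -, h7⟩ := hK₀ (j + K₀) (Nat.le_add_left _ _)
      have := (hz j).2.2.2.2
      have hXj : X (j + K₀) = (-((3 / 16) * L (j + K₀)) + δ) / μ + D := rfl
      rw [hXj]
      have hμne : (μ : ℝ) ≠ 0 := hμpos.ne'
      have key : 32 * (μ : ℝ) * -((-((3 / 16) * L (j + K₀)) + δ) / μ + D + B) =
          6 * L (j + K₀) - 32 * δ - 32 * μ * (D + B) := by
        field_simp
        ring
      rw [key]
      linarith
    · rw [neg_neg]
      exact (hz j).2.2.1

/-- **The escape sequence for a monomial fibre `q = c X^m`** (`c ≠ 0`, `m ≥ 1`, `deg p ≥ 2`):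
here the exponential points are EXACT roots of the polynomial equations
`m p(z) - z = -T_k - log c` (`e^{z} = c e^{m p(z)}`), taken along a root direction of `m p - X`
(`exists_alRoot`); `w_j = e^{p(z_j)}` decays super-polynomially. (new in this file) [folklore] -/
theorem exists_monomialSeq (hd : 2 ≤ p.natDegree) (c : ℂ) (hc : c ≠ 0) (m : ℕ) (hm : 1 ≤ m)
    (hq : ∀ w : ℂ, q.eval w = c * w ^ m) :
    ∃ z w : ℕ → ℂ, Tendsto (fun j => ‖z j‖) atTop atTop ∧ (∀ j, w j ≠ 0) ∧
      (∀ N : ℕ, Tendsto (fun j => ‖w j‖ * ‖z j‖ ^ N) atTop (𝓝 0)) ∧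
      (∀ j, exp (z j) = q.eval (w j)) ∧ ∀ j, exp (p.eval (z j)) = w j := by
  have hmC : (m : ℂ) ≠ 0 := Nat.cast_ne_zero.mpr (by omega)
  have hmR : (1 : ℝ) ≤ m := by exact_mod_cast hm
  have hmpos : (0 : ℝ) < m := by linarith
  -- the auxiliary polynomial `r = m p - X`
  set r : Polynomial ℂ := Polynomial.C (m : ℂ) * p - Polynomial.X with hr_def
  have hdeg₁ : (Polynomial.C (m : ℂ) * p).natDegree = p.natDegree := Polynomial.natDegree_C_mul hmC
  have hlt : (Polynomial.X : Polynomial ℂ).natDegree < (Polynomial.C (m : ℂ) * p).natDegree := by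
    rw [hdeg₁]
    exact lt_of_le_of_lt Polynomial.natDegree_X_le (lt_of_lt_of_le (by norm_num) hd)
  have hdeg : r.natDegree = p.natDegree := by
    rw [hr_def, Polynomial.natDegree_sub_eq_left_of_natDegree_lt hlt, hdeg₁]
  have hd' : 2 ≤ r.natDegree := hdeg ▸ hd
  have ha' : r.leadingCoeff ≠ 0 := by
    rw [Ne, Polynomial.leadingCoeff_eq_zero]
    rintro h
    rw [h] at hd'
    simp at hd'
  have hr_eval : ∀ z : ℂ, r.eval z = (m : ℂ) * p.eval z - z := by
    intro z; simp [hr_def]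
  obtain ⟨ω, s, hs, hω, hre⟩ := exists_rootDirection r.leadingCoeff ha' r.natDegree hd'
  set d : ℕ := r.natDegree with hd_def
  set ℓ : Polynomial ℂ := r.eraseLead with hℓ_def
  set c₀ : ℂ := -log c with hc₀_def
  have hc₀ : exp (-c₀) = c := by rw [hc₀_def, neg_neg, exp_log hc]
  have hω0 : ω ≠ 0 := by
    rintro rfl
    have hrhs : (2 * Real.pi * I * s : ℂ) ≠ 0 := by
      have hsC : (s : ℂ) ≠ 0 := by rcases hs with rfl | rfl <;> simp
      have hπ : (Real.pi : ℂ) ≠ 0 := Complex.ofReal_ne_zero.mpr Real.pi_pos.ne'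
      simp [hsC, hπ, Complex.I_ne_zero]
    rw [zero_pow (by omega), mul_zero] at hω
    exact hrhs hω.symm
  have hωpos : 0 < ‖ω‖ := norm_pos_iff.mpr hω0
  set C₁ : ℝ := coeffNormSum ℓ * (3 * ‖ω‖ + 1) ^ (d - 1) + ‖c₀‖ with hC₁
  set L : ℕ → ℝ := fun k => ((k : ℝ) + 1) * ‖ω‖ with hL_def
  have hL : Tendsto L atTop atTop := (tendsto_natCast_add_atTop 1).atTop_mul_const hωpos
  have hev₁ : ∀ᶠ k : ℕ in atTop, 32 * C₁ ≤ 2 * Real.pi * ((k : ℝ) + 1) :=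
    ((tendsto_natCast_add_atTop 1).const_mul_atTop (by positivity : (0 : ℝ) < 2 * Real.pi)
      ).eventually_ge_atTop _
  have hev₂ : ∀ᶠ k : ℕ in atTop, 32 * c₀.re ≤ 3 * L k :=
    (hL.const_mul_atTop (by norm_num : (0 : ℝ) < 3)).eventually_ge_atTop _
  obtain ⟨K₀, hK₀⟩ := eventually_atTop.1 (hev₁.and hev₂)
  have hsol : ∀ j : ℕ, ∃ z : ℂ, exp z = q.eval (exp (p.eval z)) ∧
      (p.eval z).re = (z.re + c₀.re) / m ∧ z.re ≤ -(3 / 16) * L (j + K₀) ∧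
      L (j + K₀) / 3 ≤ ‖z‖ ∧ ‖z‖ ≤ 3 * L (j + K₀) := by
    intro j
    obtain ⟨h1, h2⟩ := hK₀ (j + K₀) (Nat.le_add_left _ _)
    obtain ⟨z₀, hroot, hup, hlow, hre₀⟩ := exists_alRoot r hd' ω s hs hω hre c₀ (j + K₀)
      (by push_cast at h1 ⊢; linarith)
    have hLk : L (j + K₀) = (((j + K₀ : ℕ) : ℝ) + 1) * ‖ω‖ := rfl
    set T : ℂ := (((j + K₀ + 1) ^ d * s : ℤ) : ℂ) * (2 * Real.pi * I) with hT_def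
    have hTexp : exp (-T) = 1 := by
      rw [hT_def, ← neg_mul, ← Int.cast_neg]
      exact Complex.exp_int_mul_two_pi_mul_I _
    have hTre : T.re = 0 := by
      rw [hT_def, ← Complex.ofReal_intCast, Complex.re_ofReal_mul]
      simp [Complex.mul_re]
    have hroot' : (m : ℂ) * p.eval z₀ - z₀ = T + c₀ := by
      rw [← hr_eval, hroot, hT_def, hd_def]
      push_cast
      ring
    refine ⟨z₀, ?_, ?_, by rw [hLk]; exact hre₀, by rw [hLk]; exact hlow, by rw [hLk]; exact hup⟩
    · have hz : z₀ = (m : ℂ) * p.eval z₀ + -T + -c₀ := by linear_combination -hroot'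
      rw [hq, ← Complex.exp_nat_mul]
      calc exp z₀ = exp ((m : ℂ) * p.eval z₀ + -T + -c₀) := by rw [← hz]
        _ = c * exp ((m : ℂ) * p.eval z₀) := by
          rw [Complex.exp_add, Complex.exp_add, hTexp, hc₀, mul_one, mul_comm]
    · have h := congrArg Complex.re hroot'
      simp only [Complex.sub_re, Complex.add_re, hTre, zero_add] at h
      have hm' : ((m : ℂ) * p.eval z₀).re = (m : ℝ) * (p.eval z₀).re := by
        simp [Complex.mul_re]
      rw [hm'] at h
      field_simp
      linarith
  choose z hz using hsol
  refine ⟨z, fun j => exp (p.eval (z j)), ?_, fun j => exp_ne_zero _, ?_, fun j => (hz j).1,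
    fun j => rfl⟩
  · refine tendsto_norm_atTop_of_le (hL.comp (tendsto_add_atTop_nat K₀)) (a := 1 / 3) (b := 0)
      (by norm_num) fun j => ?_
    have := (hz j).2.2.2.1
    simp only [Function.comp_apply]
    linarith
  · intro N
    -- scale `K_j = ((3/16) L_{j+K₀} - Re c₀)/m`
    have hK : Tendsto (fun j => ((3 / 16) * L (j + K₀) - c₀.re) / m) atTop atTop := by
      refine Tendsto.atTop_div_const hmpos ?_
      exact tendsto_atTop_add_const_right _ _
        ((hL.comp (tendsto_add_atTop_nat K₀)).const_mul_atTop (by norm_num : (0 : ℝ) < 3 / 16))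
    refine superdecay_of_le hK (A := 32 * m) (fun j => ?_) (fun j => ?_) N
    · obtain ⟨-, h2⟩ := hK₀ (j + K₀) (Nat.le_add_left _ _)
      have := (hz j).2.2.2.2
      have key : 32 * (m : ℝ) * (((3 / 16) * L (j + K₀) - c₀.re) / m) =
          6 * L (j + K₀) - 32 * c₀.re := by
        field_simp
        ring
      rw [key]
      linarith
    · rw [Complex.norm_exp, (hz j).2.1]
      refine Real.exp_le_exp.mpr ?_
      have := (hz j).2.2.1
      rw [← neg_div]
      exact div_le_div_of_nonneg_right (by linarith) hmpos.le

end Supply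

/-! ### Part 4 — the unconditional theorems -/

section Main

variable {p q}

/-- `a ≠ 0` for the leading coefficient of a polynomial of degree `≥ 2`. [folklore] -/
theorem leadingCoeff_ne_zero_of_two_le (hd : 2 ≤ p.natDegree) : p.leadingCoeff ≠ 0 := by
  rw [Ne, Polynomial.leadingCoeff_eq_zero]
  rintro rfl
  simp at hd

/-- **Density at a nonzero root.** If `deg p ≥ 2`, `q ≠ 0` and `q(β) = 0` with `β ≠ 0` (any
multiplicity), then `I(S_{p,q} ∩ Γ_exp) = I(S_{p,q})`. (new in this file) [folklore] -/
theorem unprojectedDense_graphPolySurface_of_root (hd : 2 ≤ p.natDegree) (hq : q ≠ 0) {β : ℂ}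
    (hβ : β ≠ 0) (hqβ : q.eval β = 0) : UnprojectedDense (graphPolySurface p q) := by
  -- Taylor data of `q` at `β`: `q(β(1+t)) = Q(t) = t^μ Q_μ(t)`
  set Q : Polynomial ℂ := q.comp (Polynomial.C β * (1 + Polynomial.X)) with hQ_def
  have hQeval : ∀ t : ℂ, Q.eval t = q.eval (β * (1 + t)) := by
    intro t; simp [hQ_def, Polynomial.eval_comp]
  have hQ0 : Q ≠ 0 := by
    intro hQ
    apply hq
    refine Polynomial.eq_zero_of_infinite_isRoot q (Set.infinite_of_injective_forall_mem
      (f := fun t : ℂ => β * (1 + t)) ?_ fun t => ?_)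
    · intro t₁ t₂ h
      have := mul_left_cancel₀ hβ h
      linear_combination this
    · show q.IsRoot (β * (1 + t))
      rw [Polynomial.IsRoot, ← hQeval, hQ, Polynomial.eval_zero]
  have hQroot : Q.IsRoot 0 := by
    rw [Polynomial.IsRoot, hQeval]; simpa using hqβ
  set μ : ℕ := Q.rootMultiplicity 0 with hμ_def
  have hμ : 1 ≤ μ := (Polynomial.rootMultiplicity_pos hQ0).mpr hQroot
  set Qμ : Polynomial ℂ := Q /ₘ (Polynomial.X - Polynomial.C 0) ^ μ with hQμ_def
  have hfacQ : (Polynomial.X - Polynomial.C 0) ^ μ * Qμ = Q :=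
    Polynomial.pow_mul_divByMonic_rootMultiplicity_eq Q 0
  have hκ : Qμ.eval 0 ≠ 0 := Polynomial.eval_divByMonic_pow_rootMultiplicity_ne_zero 0 hQ0
  have hfac : ∀ t : ℂ, q.eval (β * (1 + t)) = t ^ μ * Qμ.eval t := by
    intro t
    rw [← hQeval, ← hfacQ]
    simp [Polynomial.eval_mul, Polynomial.eval_pow]
  obtain ⟨ω, s, hs, hω, hre⟩ := exists_rootDirection p.leadingCoeff
    (leadingCoeff_ne_zero_of_two_le hd) p.natDegree hd
  obtain ⟨z, w, hz, hw, hdec, h₁, h₂⟩ := exists_rootSeq hd β hβ μ hμ Qμ hfac hκ ω s hs hω hre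
  exact unprojectedDense_graphPolySurface_of_seq_at p q β z w hz hw hdec h₁ h₂

/-- **Density for monomial fibres** `q = c X^m` (`c ≠ 0`, `m ≥ 1`, `deg p ≥ 2`).
(new in this file) [folklore] -/
theorem unprojectedDense_graphPolySurface_of_monomial (hd : 2 ≤ p.natDegree) {c : ℂ} (hc : c ≠ 0)
    {m : ℕ} (hm : 1 ≤ m) (hq : q = Polynomial.C c * Polynomial.X ^ m) :
    UnprojectedDense (graphPolySurface p q) := by
  have hq' : ∀ w : ℂ, q.eval w = c * w ^ m := by intro w; simp [hq]
  obtain ⟨z, w, hz, hw, hdec, h₁, h₂⟩ := exists_monomialSeq hd c hc m hm hq'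
  exact unprojectedDense_graphPolySurface_of_seq p q z w hz hw hdec h₁ h₂

/-- **Density for the whole crossed family with non-constant fibre polynomial**: `deg p ≥ 2` and
`deg q ≥ 1` imply `I(S_{p,q} ∩ Γ_exp) = I(S_{p,q})`. Either `q` has a nonzero root
(`unprojectedDense_graphPolySurface_of_root`) or `q = c X^m`
(`unprojectedDense_graphPolySurface_of_monomial`). (new in this file) [folklore] -/
theorem unprojectedDense_graphPolySurface_of_natDegree_pos (hd : 2 ≤ p.natDegree)
    (hq : 0 < q.natDegree) : UnprojectedDense (graphPolySurface p q) := by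
  have hq0 : q ≠ 0 := by rintro rfl; simp at hq
  obtain ⟨q₁, hq₁, hndvd⟩ := Polynomial.exists_eq_pow_rootMultiplicity_mul_and_not_dvd q hq0 0
  set m : ℕ := q.rootMultiplicity 0 with hm_def
  have hq₁0 : q₁.eval 0 ≠ 0 := by
    intro h
    apply hndvd
    rw [Polynomial.dvd_iff_isRoot]
    exact h
  have hq₁ne : q₁ ≠ 0 := by rintro rfl; simp at hq₁0
  by_cases h1 : 0 < q₁.natDegree
  · -- a nonzero root of `q₁` is a nonzero root of `q`
    obtain ⟨β, hβ⟩ := Complex.exists_root (Polynomial.natDegree_pos_iff_degree_pos.mp h1)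
    have hβ0 : β ≠ 0 := by rintro rfl; exact hq₁0 hβ
    refine unprojectedDense_graphPolySurface_of_root hd hq0 hβ0 ?_
    rw [hq₁, Polynomial.eval_mul, hβ.eq_zero, mul_zero]
  · -- `q₁` is a nonzero constant: `q = c X^m` with `m ≥ 1`
    have h0 : q₁.natDegree = 0 := by omega
    have hq₁C : q₁ = Polynomial.C (q₁.coeff 0) := Polynomial.eq_C_of_natDegree_eq_zero h0
    have hc : q₁.coeff 0 ≠ 0 := by rwa [Polynomial.coeff_zero_eq_eval_zero]
    have hqm : q = Polynomial.C (q₁.coeff 0) * Polynomial.X ^ m := by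
      conv_lhs => rw [hq₁, hq₁C]
      rw [map_zero, sub_zero, mul_comm]
    have hm : 1 ≤ m := by
      by_contra hm0
      have hm0' : m = 0 := by omega
      rw [hqm, hm0', pow_zero, mul_one, Polynomial.natDegree_C] at hq
      exact lt_irrefl _ hq
    exact unprojectedDense_graphPolySurface_of_monomial hd hc hm hqm

/-- **Mantova–Masser's density question on the crossed family — positive answer**: for every
`p` with `deg p ≥ 2` and every non-constant `q`, the surface `S_{p,q} = {x₁ = p(x₀), y₀ = q(y₁)}`
is in case (dim-pi-S-1-free) AND its exponential points are Zariski dense.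
(new in this file) [folklore] -/
theorem unprojectedDensityQuestion_instance_crossed (hd : 2 ≤ p.natDegree) (hq : 0 < q.natDegree) :
    MMCaseDimPiOneFree (graphPolySurface p q) ∧ UnprojectedDense (graphPolySurface p q) :=
  ⟨mmCase_graphPolySurface_of_two_le hd (by rintro rfl; simp at hq),
    unprojectedDense_graphPolySurface_of_natDegree_pos hd hq⟩

/-- Example: `{x₁ = -x₀², y₀ = y₁² + 1}` — the solutions of `e^{z} = e^{-2z²} + 1` are Zariski dense
(outside the leading-coefficient criterion of `EACDensityFamilies`, and `q` is not affine).
[folklore] -/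
example : MMCaseDimPiOneFree (graphPolySurface (-Polynomial.X ^ 2) (Polynomial.X ^ 2 + 1)) ∧
    UnprojectedDense (graphPolySurface (-Polynomial.X ^ 2) (Polynomial.X ^ 2 + 1)) :=
  unprojectedDensityQuestion_instance_crossed
    (by rw [Polynomial.natDegree_neg, Polynomial.natDegree_X_pow])
    (by
      have : (Polynomial.X ^ 2 + 1 : Polynomial ℂ).natDegree = 2 := by
        rw [← Polynomial.C_1, Polynomial.natDegree_X_pow_add_C]
      omega)

/-- Example (multiple root): `{x₁ = x₀³, y₀ = (y₁ - 1)²}` — `e^{z} = (e^{z³} - 1)²` has Zariski-dense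
solutions. [folklore] -/
example : MMCaseDimPiOneFree (graphPolySurface (Polynomial.X ^ 3) ((Polynomial.X - 1) ^ 2)) ∧
    UnprojectedDense (graphPolySurface (Polynomial.X ^ 3) ((Polynomial.X - 1) ^ 2)) :=
  unprojectedDensityQuestion_instance_crossed (by rw [Polynomial.natDegree_X_pow]; norm_num)
    (by
      have : ((Polynomial.X - 1) ^ 2 : Polynomial ℂ).natDegree = 2 := by
        rw [← Polynomial.C_1, Polynomial.natDegree_pow, Polynomial.natDegree_X_sub_C]
      omega)

/-- Example (monomial fibre, `q(0) = 0`): `{x₁ = x₀², y₀ = y₁³}` — `e^{z} = e^{3z²}` has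
Zariski-dense solutions in the surface. [folklore] -/
example : MMCaseDimPiOneFree (graphPolySurface (Polynomial.X ^ 2) (Polynomial.X ^ 3)) ∧
    UnprojectedDense (graphPolySurface (Polynomial.X ^ 2) (Polynomial.X ^ 3)) :=
  unprojectedDensityQuestion_instance_crossed (by rw [Polynomial.natDegree_X_pow])
    (by rw [Polynomial.natDegree_X_pow]; norm_num)

end Main

end Literature.ModelTheory.Zilber
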